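import Summits.QuantumAdvantage.AdviceFreeQNC0.AffBells25RigidityChain
import Summits.QuantumAdvantage.AdviceFreeQNC0.WalkCharacters
import Mathlib.Algebra.CharP.Two
import HarnessLib

/-!
# Theorem B′ chain, part 1: the ring `R = 𝔽₂[ω]/(ω²+ω+1)`, the test identity (L1) and orthogonality (L2)

Prover seat qn-prover-3 g14 (ask P-25 of planner qn-p1 g25, ROUND-24 §2.10).  Over the typed chain
`AffBells25RigidityChain.lean` (= Sketch25L verbatim) we prove:

* arithmetic of `R = AdjoinRoot (X²+X+1 : 𝔽₂[X])`: `R` and `ω` are (definitionally) the cell's `F4` and `F4.ω` of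
  `WalkCharacters.lean` (`omega_eq_F4 : ω = F4.ω := rfl`), whose lemmas (`F4.two_eq_zero`, `F4.omega_sq`,
  `F4.omega_pow_mod`, `F4.add_self`, `F4.nontrivial`, …) are reused rather than restated; new here: the character
  property `ωpow (a+b) = ωpow a · ωpow b`, the two-term sums `ωpow a + ωpow (-a) = 1`, `1 + ωpow a = ωpow (-a)`
  (`a ≠ 0`), units, and the INDEPENDENCE of `{1, ω}` over `𝔽₂` in the counting form `a + b·ω = 0 ⇒ a, b even`
  (from `1 ≠ 0` alone — no field structure on `R` is used anywhere in the chain);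
* **`testIdentity : TestIdentity`** (L1): `[L = c] = 1 + ω^{L−c} + ω^{2(L−c)}`;
* **`orthogonality : Orthogonality`** (L2): `Σ_y ω^{−⟨δ,1−y⟩} ω^{⟨γ,y⟩} = [γ = δ]` for sign vectors, as the product
  `∏_e (ω^{γ_e} + ω^{−δ_e})` (`Fintype.prod_sum`), each factor being `1` (`γ_e = δ_e`) or `0` (`γ_e = −δ_e`);
* the kernel mass `Σ_y ω^{−⟨δ,1−y⟩} = ω^{⟨δ,1⟩}` and the factorisation `ω^{−⟨δ,1−y⟩} = ω^{−⟨δ,1⟩}·χ_δ(y)`.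

WHAT THIS IS NOT: instrument for the (NP₀) rung of crux stmt-QuantumAdvantage-22907 (route DWalkThree); no route item;
separation NOT moved.
-/

namespace Summit.QuantumAdvantage.AdviceFreeQNC0

namespace AffBells25L

open Finset AffBells24 Polynomial

/-! ### The ring `R` (= the cell's `F4`) -/

/-- Bridge: the chain's `ω` IS `F4.ω` of `WalkCharacters.lean` (same term), and `R` is `F4` (same abbreviation). -/
theorem omega_eq_F4 : ω = F4.ω := rfl

/-- Cancellation in characteristic two: `a + b = c → b = a + c`. -/
theorem eq_add_of_add_eq {a b c : R} (h : a + b = c) : b = a + c := by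
  rw [← h, ← add_assoc, F4.add_self, zero_add]

/-- `R` is nontrivial: `(1 : R) ≠ 0`. -/
theorem one_ne_zero_R : (1 : R) ≠ 0 := by
  haveI := F4.nontrivial
  exact one_ne_zero

/-- `R` has characteristic `2` (as a `CharP` structure, to be introduced locally with `haveI`). -/
theorem charP_two : CharP R 2 :=
  CharTwo.of_one_ne_zero_of_two_eq_zero one_ne_zero_R F4.two_eq_zero

/-! ### `ωpow` -/

/-- `ωpow 0 = 1`. -/
theorem ωpow_zero : ωpow 0 = 1 := by
  simp [ωpow]

/-- `ωpow 1 = ω`. -/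
theorem ωpow_one : ωpow 1 = ω := by
  show ω ^ (1 : ZMod 3).val = ω
  rw [show (1 : ZMod 3).val = 1 from rfl, pow_one]

/-- `ωpow 2 = ω²`. -/
theorem ωpow_two : ωpow 2 = ω ^ 2 := by
  show ω ^ (2 : ZMod 3).val = ω ^ 2
  rw [show (2 : ZMod 3).val = 2 from rfl]

/-- `ωpow` is a character: `ωpow (a + b) = ωpow a * ωpow b`. -/
theorem ωpow_add (a b : ZMod 3) : ωpow (a + b) = ωpow a * ωpow b := by
  unfold ωpow
  rw [ZMod.val_add, omega_eq_F4, ← F4.omega_pow_mod, pow_add]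

/-- `ωpow (-a) * ωpow a = 1`. -/
theorem ωpow_neg_mul (a : ZMod 3) : ωpow (-a) * ωpow a = 1 := by
  rw [← ωpow_add, neg_add_cancel, ωpow_zero]

/-- `ωpow a * ωpow (-a) = 1`. -/
theorem ωpow_mul_neg (a : ZMod 3) : ωpow a * ωpow (-a) = 1 := by
  rw [mul_comm, ωpow_neg_mul]

/-- `ωpow a ≠ 0`. -/
theorem ωpow_ne_zero (a : ZMod 3) : ωpow a ≠ 0 := by
  intro h
  have := ωpow_neg_mul a
  rw [h, mul_zero] at this
  exact one_ne_zero_R this.symm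

/-- Units cancel: `ωpow a * x = 0 → x = 0`. -/
theorem eq_zero_of_ωpow_mul_eq_zero {a : ZMod 3} {x : R} (h : ωpow a * x = 0) : x = 0 := by
  have : ωpow (-a) * (ωpow a * x) = 0 := by rw [h, mul_zero]
  rwa [← mul_assoc, ωpow_neg_mul, one_mul] at this

/-- `ωpow (2a) = (ωpow a)²`. -/
theorem ωpow_two_mul (a : ZMod 3) : ωpow (2 * a) = ωpow a ^ 2 := by
  rw [two_mul a, ωpow_add, pow_two (ωpow a)]

/-- `ωpow (-a) = (ωpow a)²` (in `ZMod 3`, `-a = 2a`). -/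
theorem ωpow_neg (a : ZMod 3) : ωpow (-a) = ωpow a ^ 2 := by
  have : -a = 2 * a := by revert a; decide
  rw [this, ωpow_two_mul]

/-- `ωpow` of a sum is the product. -/
theorem ωpow_sum {ι : Type*} (s : Finset ι) (f : ι → ZMod 3) :
    ωpow (∑ i ∈ s, f i) = ∏ i ∈ s, ωpow (f i) := by
  induction s using Finset.cons_induction with
  | empty => simp [ωpow_zero]
  | cons a s ha ih => rw [sum_cons, prod_cons, ωpow_add, ih]

/-- The two nontrivial powers sum to one: `ωpow a + ωpow (-a) = 1` for `a ≠ 0` (`ω + ω² = 1`). -/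
theorem ωpow_add_ωpow_neg {a : ZMod 3} (ha : a ≠ 0) : ωpow a + ωpow (-a) = 1 := by
  have key : ω + ω ^ 2 = 1 := by
    rw [omega_eq_F4]; exact F4.omega_add_omega_sq
  have h : a = 1 ∨ a = 2 := by revert a; decide
  rcases h with rfl | rfl
  · have : (-1 : ZMod 3) = 2 := rfl
    rw [this, ωpow_one, ωpow_two, key]
  · have : (-2 : ZMod 3) = 1 := rfl
    rw [this, ωpow_one, ωpow_two, add_comm, key]

/-- `1 + ωpow a = ωpow (-a)` for `a ≠ 0` (`1 + ω = ω²`, `1 + ω² = ω`). -/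
theorem one_add_ωpow {a : ZMod 3} (ha : a ≠ 0) : 1 + ωpow a = ωpow (-a) := by
  rw [← ωpow_add_ωpow_neg ha, add_comm (ωpow a), add_assoc, F4.add_self, add_zero]

/-- `1 + ωpow (-a) = ωpow a` for `a ≠ 0`. -/
theorem one_add_ωpow_neg {a : ZMod 3} (ha : a ≠ 0) : 1 + ωpow (-a) = ωpow a := by
  have := one_add_ωpow (neg_ne_zero.mpr ha)
  rwa [neg_neg] at this

/-- Two equal powers cancel: `ωpow a + ωpow a = 0`. -/
theorem ωpow_add_self (a : ZMod 3) : ωpow a + ωpow a = 0 := F4.add_self _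

/-! ### Independence of `{1, ω}` over `𝔽₂` (counting form) -/

/-- Natural-number casts into `R` only depend on the parity. -/
theorem natCast_eq_mod (n : ℕ) : (n : R) = ((n % 2 : ℕ) : R) := by
  haveI := charP_two
  exact CharTwo.natCast_eq_mod n

/-- INDEPENDENCE: `a + b·ω = 0` in `R` with `a b : ℕ` forces `a` and `b` even (uses only `1 ≠ 0`, `ω³ = 1`,
`1 + ω = ω²`). -/
theorem even_of_natCast_add_natCast_mul_omega {a b : ℕ} (h : (a : R) + (b : R) * ω = 0) :
    a % 2 = 0 ∧ b % 2 = 0 := by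
  rw [natCast_eq_mod a, natCast_eq_mod b] at h
  have ha : a % 2 = 0 ∨ a % 2 = 1 := Nat.mod_two_eq_zero_or_one a
  have hb : b % 2 = 0 ∨ b % 2 = 1 := Nat.mod_two_eq_zero_or_one b
  rcases ha with ha | ha <;> rcases hb with hb | hb <;> rw [ha, hb] at h
  · exact ⟨ha, hb⟩
  · exfalso
    rw [Nat.cast_zero, Nat.cast_one, zero_add, one_mul] at h
    have h3 : ω ^ 3 = 1 := by rw [omega_eq_F4, F4.omega_pow_mod]; rfl
    rw [h, zero_pow (by norm_num)] at h3
    exact one_ne_zero_R h3.symm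
  · exfalso
    rw [Nat.cast_one, Nat.cast_zero, zero_mul, add_zero] at h
    exact one_ne_zero_R h
  · exfalso
    rw [Nat.cast_one, one_mul] at h
    have h2 : ω ^ 2 = 0 := by
      rw [← ωpow_two, ← (show (-1 : ZMod 3) = 2 from rfl), ← one_add_ωpow (a := 1) (by decide), ωpow_one]
      exact h
    have h3 : ω ^ 3 = 0 := by rw [pow_succ, h2, zero_mul]
    rw [omega_eq_F4, F4.omega_pow_mod, show (3 % 3 : ℕ) = 0 from rfl, pow_zero] at h3
    exact one_ne_zero_R h3

/-! ### (L1) the test identity -/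

/-- **(L1)** `[L = c] = 1 + ω^{L−c} + ω^{2(L−c)}` in `R`. -/
theorem testIdentity : TestIdentity := by
  intro L c
  have omega_rel : ω ^ 2 + ω + 1 = 0 := by
    rw [omega_eq_F4]
    linear_combination F4.omega_add_omega_sq + F4.two_eq_zero
  have hiff : L = c ↔ L - c = 0 := sub_eq_zero.symm
  have h3 : ∀ d : ZMod 3, d = 0 ∨ d = 1 ∨ d = 2 := by decide
  rcases h3 (L - c) with hd | hd | hd <;> rw [hd] at hiff ⊢
  · rw [if_pos (hiff.mpr rfl), mul_zero, ωpow_zero, F4.add_self, zero_add]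
  · rw [if_neg (by rw [hiff]; decide), mul_one, ωpow_one, ωpow_two]
    linear_combination (-1 : R) * omega_rel
  · rw [if_neg (by rw [hiff]; decide)]
    have : (2 * 2 : ZMod 3) = 1 := rfl
    rw [this, ωpow_one, ωpow_two]
    linear_combination (-1 : R) * omega_rel

/-- The test as an element of `R`: `[test γ c y] = 1 + ω^{−c} χ_γ(y) + ω^{c} χ_{−γ}(y)`. -/
theorem test_eq {Z : ℕ} (γ : Fin Z → ZMod 3) (c : ZMod 3) (y : Fin Z → Bool) :
    (if test γ c y then (1 : R) else 0) = 1 + ωpow (-c) * chi γ y + ωpow c * chi (-γ) y := by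
  have h := testIdentity (∑ e, if y e then γ e else 0) c
  have hdec : (if test γ c y then (1 : R) else 0) =
      if (∑ e, if y e then γ e else 0) = c then (1 : R) else 0 := by
    unfold test
    by_cases hc : (∑ e, if y e then γ e else 0) = c
    · rw [if_pos hc, decide_eq_true hc, if_pos rfl]
    · rw [if_neg hc, decide_eq_false hc]; rfl
  rw [hdec, h]
  have e1 : ωpow ((∑ e, if y e then γ e else 0) - c) = ωpow (-c) * chi γ y := by
    rw [sub_eq_add_neg, add_comm, ωpow_add]; rfl
  have e2 : ωpow (2 * ((∑ e, if y e then γ e else 0) - c)) = ωpow c * chi (-γ) y := by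
    have h2 : (2 : ZMod 3) = -1 := rfl
    rw [h2, neg_one_mul, neg_sub, sub_eq_add_neg, ωpow_add]
    unfold chi
    congr 2
    rw [← sum_neg_distrib]
    refine sum_congr rfl fun e _ => ?_
    by_cases hy : y e
    · rw [if_pos hy, if_pos hy, Pi.neg_apply]
    · rw [if_neg hy, if_neg hy, neg_zero]
  rw [e1, e2]

/-! ### (L2) orthogonality -/

/-- Pointwise factorisation of the kernel against a character:
`ω^{−⟨δ,1−y⟩}·χ_γ(y) = ∏_e (if y_e then ω^{γ_e} else ω^{−δ_e})`. -/
theorem dualKer_mul_chi {Z : ℕ} (γ δ : Fin Z → ZMod 3) (y : Fin Z → Bool) :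
    dualKer δ y * chi γ y = ∏ e, (if y e then ωpow (γ e) else ωpow (-(δ e))) := by
  unfold dualKer chi
  rw [← ωpow_add, ← sum_neg_distrib, ← sum_add_distrib, ωpow_sum]
  refine prod_congr rfl fun e _ => ?_
  by_cases hy : y e
  · rw [if_pos hy, if_pos hy, if_pos hy, neg_zero, zero_add]
  · rw [if_neg hy, if_neg hy, if_neg hy, add_zero]

/-- The character sum as a product of two-term sums:
`Σ_y ω^{−⟨δ,1−y⟩} χ_γ(y) = ∏_e (ω^{γ_e} + ω^{−δ_e})`. -/
theorem sum_dualKer_mul_chi {Z : ℕ} (γ δ : Fin Z → ZMod 3) :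
    (∑ y : Fin Z → Bool, dualKer δ y * chi γ y) = ∏ e, (ωpow (γ e) + ωpow (-(δ e))) := by
  simp_rw [dualKer_mul_chi]
  rw [← Fintype.prod_sum fun e (b : Bool) => if b then ωpow (γ e) else ωpow (-(δ e))]
  refine prod_congr rfl fun e _ => ?_
  rw [Fintype.sum_bool, if_pos rfl, if_neg Bool.false_ne_true]

/-- In `ZMod 3`, two non-zero elements are equal or opposite. -/
theorem eq_or_eq_neg_of_ne_zero {a b : ZMod 3} (ha : a ≠ 0) (hb : b ≠ 0) : a = b ∨ a = -b := by
  revert a b; decide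

/-- **(L2)** ORTHOGONALITY: `Σ_y ω^{−⟨δ,1−y⟩} χ_γ(y) = [γ = δ]` for sign vectors `γ, δ`. -/
theorem orthogonality : Orthogonality := by
  intro Z γ δ hγ hδ
  rw [sum_dualKer_mul_chi]
  by_cases h : γ = δ
  · subst h
    rw [if_pos rfl]
    refine prod_eq_one fun e _ => ωpow_add_ωpow_neg (hγ e)
  · rw [if_neg h]
    obtain ⟨e, he⟩ : ∃ e, γ e ≠ δ e := by
      by_contra hne
      push Not at hne
      exact h (funext hne)
    apply prod_eq_zero (mem_univ e)
    rcases eq_or_eq_neg_of_ne_zero (hγ e) (hδ e) with h1 | h1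
    · exact absurd h1 he
    · rw [h1, ωpow_add_self]

/-- The kernel mass: `Σ_y ω^{−⟨δ,1−y⟩} = ω^{⟨δ,1⟩}` for a sign vector `δ`. -/
theorem sum_dualKer {Z : ℕ} (δ : Fin Z → ZMod 3) (hδ : IsSign δ) :
    (∑ y : Fin Z → Bool, dualKer δ y) = piOne δ := by
  have h := sum_dualKer_mul_chi (0 : Fin Z → ZMod 3) δ
  have hchi : ∀ y : Fin Z → Bool, chi (0 : Fin Z → ZMod 3) y = 1 := by
    intro y
    unfold chi
    rw [sum_eq_zero fun e _ => ?_, ωpow_zero]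
    split_ifs <;> rfl
  simp_rw [hchi, mul_one] at h
  rw [h]
  unfold piOne
  rw [ωpow_sum]
  refine prod_congr rfl fun e _ => ?_
  rw [Pi.zero_apply, ωpow_zero, one_add_ωpow_neg (hδ e)]

/-- The kernel is a twisted character: `ω^{−⟨δ,1−y⟩} = ω^{−⟨δ,1⟩}·χ_δ(y)`. -/
theorem dualKer_eq {Z : ℕ} (δ : Fin Z → ZMod 3) (y : Fin Z → Bool) :
    dualKer δ y = ωpow (-(∑ e, δ e)) * chi δ y := by
  unfold dualKer chi
  rw [← ωpow_add, ← sum_neg_distrib, ← sum_neg_distrib, ← sum_add_distrib]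
  congr 1
  refine sum_congr rfl fun e _ => ?_
  by_cases hy : y e
  · rw [if_pos hy, if_pos hy, neg_zero, neg_add_cancel]
  · rw [if_neg hy, if_neg hy, add_zero]

end AffBells25L

end Summit.QuantumAdvantage.AdviceFreeQNC0
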